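import Literature.AlgebraicGeometry.Resolution.WeightedCentreBottomClimb
import HarnessLib

/-!
# Weighted centres — THEOREM A⁺, the slot form after the bottom climb (`E := Φ⁻¹X′` is a pure `σ^{p+1}`-translation)

Instrument for engine 1's `W(f)` TOY MODEL (cell `pub-rosobs`, LF-MODEL-eng1-g45 §6.2 THEOREM A⁺, case `2 ≤ r ≤ p − 1`: "Conclusion: `E := Φ⁻¹X′ ∈ 𝔄_{p+1}`, a central
pure `f`-translation `f ↦ f + σ^{p+1}d`"), NOT a resolution theorem and NOT about the invariant of [AbramovichTemkinWlodarczyk2024].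

* `exists_eq_add_C_mul_X_pow` — two GRADED ring endomorphisms of `k[ε][σ]` (`wt σ = 1`, slot weights `≥ 0`) that agree on the slot `ε_i` modulo `σ^n`, `w i ≤ n`, differ there by
  `a·σ^n` with `a ∈ k[ε]` weighted-homogeneous of weight `w i − n` (so `a = 0` if `w i < n`, and `a` has weight `0` if `w i = n`): total-weight bookkeeping;
* `exists_slot_form` — in the setting of `X_pow_dvd_sub_flow`: `x(ε_i) = Φ_𝔇(σ^r)(ε_i) + a_i σ^{p+1}` with `a_i` of weight `w i − (p + 1) ≤ 0` on every slot of weight `≤ p + 1`.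

References: [Lang2002, Ch. IV §1]; [Matsumura1987, §27]; [AbramovichTemkinWlodarczyk2024, §5.1 (p. 1575), Thm. 5.3.1 (2)–(3) (p. 1578)].
-/

namespace Literature.AlgebraicGeometry.Resolution.WeightedBlowup.BottomClimb

open Polynomial OrderFiltration LevelProjection EigenLiftLevels EigenLift TruncatedFlow ZKernel

variable {k : Type*} [CommRing k] {ι : Type*}

variable {w : ι → ℚ} {p : ℕ} [Fact p.Prime] [CharP k p] {u : ℕ → k}

omit [Fact p.Prime] [CharP k p] in
/-- **Slot form from a congruence**: graded `F ≡ G (mod σ^n)` on the slot `ε_i`, `w i ≤ n` ⇒ `F(ε_i) = G(ε_i) + a σ^n` with `a ∈ k[ε]` weighted-homogeneous of weight `w i − n`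
(the `σ^s`-coefficient of the difference weighs `w i − s < 0` for `s > n`, `UnipotentInverse.isWeightedHomogeneous_eq_zero_of_neg`; bookkeeping).
[cite: AbramovichTemkinWlodarczyk2024, Thm. 5.3.1 (2)-(3) (p. 1578); Lang2002, Ch. IV §1] -/
theorem exists_eq_add_C_mul_X_pow (hw : ∀ i, 0 ≤ w i) {F G : (MvPolynomial ι k)[X] →+* (MvPolynomial ι k)[X]}
    (hF : IsGradedHom w (1 : ℚ) F) (hG : IsGradedHom w (1 : ℚ) G) {n : ℕ} {i : ι} (hi : w i ≤ n)
    (hdvd : X ^ n ∣ F (C (MvPolynomial.X i)) - G (C (MvPolynomial.X i))) :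
    ∃ a : MvPolynomial ι k, MvPolynomial.IsWeightedHomogeneous w a (w i - n) ∧
      F (C (MvPolynomial.X i)) = G (C (MvPolynomial.X i)) + C a * X ^ n := by
  set Δ := F (C (MvPolynomial.X i)) - G (C (MvPolynomial.X i)) with hΔ
  have hTW : IsTW w (1 : ℚ) (w i) Δ := by
    rw [hΔ, sub_eq_add_neg]
    exact (hF.isTW_CX i).add (hG.isTW_CX i).neg
  obtain ⟨t, ht⟩ := hdvd
  refine ⟨Δ.coeff n, ?_, ?_⟩
  · have h := hTW n
    rwa [nsmul_eq_mul, mul_one] at h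
  · rw [← sub_eq_iff_eq_add', ← hΔ]
    refine Polynomial.ext fun s => ?_
    rw [Polynomial.coeff_C_mul_X_pow]
    split_ifs with hs
    · rw [hs]
    · rcases lt_or_gt_of_ne hs with hs' | hs'
      · rw [ht, Polynomial.coeff_X_pow_mul', if_neg (not_le.mpr hs')]
      · refine UnipotentInverse.isWeightedHomogeneous_eq_zero_of_neg hw (hTW s) ?_
        rw [nsmul_eq_mul, mul_one]
        have hns : (n : ℚ) < s := by exact_mod_cast hs'
        linarith

/-- **THEOREM A⁺, THE SLOT FORM AFTER THE CLIMB** (LF-MODEL-eng1-g45 §6.2: "`E := Φ⁻¹X′ ∈ 𝔄_{p+1}`, a central pure `f`-translation `f ↦ f + σ^{p+1}d`"): in the setting of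
`X_pow_dvd_sub_flow` (`2 ≤ r ≤ p − 1`, eigen-relation `s_{μ₀} x = x^{n₀} h`, `h ∈ 𝔄_{p+1}`), on every slot of weight `w i ≤ p + 1`:
`x(ε_i) = Φ_𝔇(σ^r)(ε_i) + a_i σ^{p+1}` with `a_i ∈ k[ε]` weighted-homogeneous of weight `w i − (p + 1)` — hence `a_i = 0` unless `w i = p + 1`, where `a_i` has weight `0` (a constant
when all slot weights are positive).  Instrument for engine 1's `W(f)` toy model, NOT a resolution theorem.
[cite: Lang2002, Ch. IV §1; Matsumura1987, §27 (pp. 207–209); AbramovichTemkinWlodarczyk2024, §5.1 (p. 1575), Thm. 5.3.1 (2)–(3) (p. 1578)] -/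
theorem exists_slot_form (hu : ∀ n < p, (Nat.factorial n : k) * u n = 1) (hw : ∀ i, 0 ≤ w i)
    {x : (MvPolynomial ι k)[X] ≃+* (MvPolynomial ι k)[X]} (hxg : x ∈ graded w (1 : ℚ)) (hxb : x ∈ baseFixing)
    (hxV : ∀ i, (p : ℚ) + 1 < w i → x (C (MvPolynomial.X i)) = C (MvPolynomial.X i)) {r : ℕ} (hr2 : 2 ≤ r) (hrp : r ≤ p - 1)
    (hl : x ∈ level (X : (MvPolynomial ι k)[X]) r) {μ₀ : (ZMod p)ˣ} (hμ₀ : orderOf μ₀ = p - 1) {n₀ : ℕ} (hn₀ : (n₀ : ZMod p) = (μ₀ : ZMod p) ^ r)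
    {h : (MvPolynomial ι k)[X] ≃+* (MvPolynomial ι k)[X]} (hhg : h ∈ graded w (1 : ℚ)) (hhb : h ∈ baseFixing)
    (hhV : ∀ i, (p : ℚ) + 1 < w i → h (C (MvPolynomial.X i)) = C (MvPolynomial.X i)) (hhl : h ∈ level (X : (MvPolynomial ι k)[X]) (p + 1))
    (hsx : scaleConj (castUnit p μ₀) x = x ^ n₀ * h) {i : ι} (hi : w i ≤ (p : ℚ) + 1) :
    ∃ a : MvPolynomial ι k, MvPolynomial.IsWeightedHomogeneous w a (w i - ((p : ℚ) + 1)) ∧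
      x (C (MvPolynomial.X i)) = flow (projDer r x) p u (C 1 * X ^ r) (C (MvPolynomial.X i)) + C a * X ^ (p + 1) := by
  have hdvd := X_pow_dvd_sub_flow hu hw hxg hxb hxV hr2 hrp hl hμ₀ hn₀ hhg hhb hhV hhl hsx (C (MvPolynomial.X i))
  have hD' : ∀ (b : MvPolynomial ι k) (m : ℚ), MvPolynomial.IsWeightedHomogeneous w b m →
      MvPolynomial.IsWeightedHomogeneous w (projDer r x b) (m - r • (1 : ℚ)) := fun b m hb => by
    rw [nsmul_one]
    exact TailedLightFlow.lowers_of_X _ (fun j => isWeightedHomogeneous_projDer hxg.1 r j) hb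
  have hG : IsGradedHom w (1 : ℚ) (flow (projDer r x) p u (C 1 * X ^ r)) := isGradedHom_flow_C_mul_X_pow (projDer r x) p u hD' 1
  have hi' : w i ≤ ((p + 1 : ℕ) : ℚ) := by push_cast; exact hi
  obtain ⟨a, ha, he⟩ := exists_eq_add_C_mul_X_pow hw hxg.1 hG hi' hdvd
  refine ⟨a, ?_, he⟩
  push_cast at ha
  exact ha

end Literature.AlgebraicGeometry.Resolution.WeightedBlowup.BottomClimb
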